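import Summits.QuantumFields.YangMills.Theorems.AlphaInputsT3ACv3DataSchemaXChi
import HarnessLib

/-!
# `AlphaInputsT3ACv3DataSchemaSelChi` — THE «SELECTION» RE-DISPLAY OF THE χ DATA ROWS (O″χ) OF 2′χ: the supplier hands ONE measurable IN-CLASS minimiser selection
# together with ITS cluster-expansion data, instead of data for EVERY argmin selection over the seam-blind class — lane `pub-balaban3d`, width seat alpha-2 (g7)

WHY (cell `ym3-torus`, route `UnitScaleTilt`, crux `HistoryTailL` = stmt-QuantumFields-19936, stub 2′χ `stub_laneRecordsV3Chi`; this seat's NODE-O d = 3 bill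
`pub/pub-balaban3d/NODE-O-d3-BILL-alpha2-g7.md`, located points L1∕L2).  The display of record (`…v3RecordXChi` §3 `PinnedPartsT3ACRecFLChi`) carries per family the pair
{(FL) `InnerFineLiftsT3`, (O″χ) `DataRowsT3XChi`}, where (O″χ) asks for expansion data for EVERY seam-blind adapted minimiser data `AdaptedToT3X … Ut UkH` (pinned,
measurable, ARGMIN of the Wilson action over `𝒞_X(k, h, W)`).  Reading the χ assembly `ofV3ChiAt_of_dataSchemaT3XChi` shows that it consumes from `AdaptedToT3X` ONLY
the pin at the trivial history, measurability and MEMBERSHIP `UkH k h W ∈ 𝒞_X(k, h, W)` at admissible non-trivial `(k, h)`: the `IsMinOn` conjunct is never used (it only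
restricts which selections the supplier must serve) and (D6X) `AdaptedClassNonemptyT3X` is used only to make the argmin selector exist.  THIS FILE types the display in
which the supplier hands the selection itself — print's own shape ([Balaban1985UV3] Sect. C speaks about ITS (42)-minimiser map `U_k(·, h)` and ITS expansion):
* §1 `AlphaInputsT3AC.InClassSelT3X K Ut UkH` — «`UkH` is pinned to `Ut` at `triv`, measurable, and IN the seam-blind class at admissible non-trivial histories» (the row a
  supplier proves about print's regional minimiser map: [Balaban1985Variational] Thm 1 (8), (12)–(13) regional regularity); (O‴χ) `AlphaInputsT3AC.DataRowsT3XChiSel K Ut`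
  — «∃ such a selection with expansion data `𝔖`, `𝔄` satisfying the χ step data at every `k < K` and the terminal `Pint_K` rows» (the three conjuncts of `DataRowsT3XChi`
  VERBATIM); `DataSchemaT3ACXChiSel` — (N1) ∧ ∃ `Ut`, (D5) ∧ (O‴χ), with NO non-emptiness conjunct.
* §2 ★ `AlphaInputsT3AC.ofV3ChiAt_of_dataSchemaT3XChiSel : DataSchemaT3ACXChiSel F 𝔠 a₀ a₁ → AlphaInputsT3AC.OfV3ChiAt F 𝔠 a₀ a₁` (the χ assembly minus the
  selector block).
* §3 OLD ⇒ NEW (nothing lost): ★ `AlphaInputsT3AC.dataRowsT3XChiSel_of_dataRows` ((D6X) + (O″χ) ⇒ (O‴χ), through the measurable argmin selector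
  `exists_selector_adaptedClassT3X` — this is exactly where (D6X), hence (FL), is consumed) and `dataSchemaT3ACXChiSel_of_dataSchemaT3ACXChi`.
* §4 the knits from [7] Thm 1 + sizes + (O‴χ) for every pinned family: `dataSchemaT3ACXChiSel_of_pinnedRows`, ★ `ofV3ChiAt_of_pinnedRowsSelChi`, and the closed-form
  sizes version `ofV3ChiAt_of_pinnedRows₂SelChi` (NO `7L + 3 ≤ M₁` row: the collar was only needed for the uncharged half of (D6X)).
HONEST FRAMING.  `def … : Prop` below are HYPOTHESIS SCHEMAS, OPEN, never asserted; the theorems are bookkeeping ∕ measurable selection around DISPLAYED rows of a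
conditional route.  (O‴χ) is WEAKER than (D6X) ∧ (O″χ) (§3) and is print's own burden (its minimiser map + its Sect. B–C expansion; the regional-regularity content of
`InClassSelT3X` for print's map is [Balaban1985Variational] Thm 1 at non-trivial histories, NOT proved here).  Nothing of the cluster expansion, of [Balaban1985Variational]
Thm 1 or of [Balaban1985Averaging] is proved or asserted.  Count-neutral helper toward 2′χ (`--supports stmt-QuantumFields-19936`); registry untouched; whether this display
replaces the (FL)-display of record is the route OWNER's decision, not this file's.  YM₃ on the torus is a RUNG of the programme (UV stability ∕ continuum limit on T³),
not the Clay problem: nothing here is a claim about d = 4, infinite volume, or a mass gap.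

References: T. Bałaban, Commun. Math. Phys. 102 (1985) 255–275 [Balaban1985UV3] (Thm 2 p.272, (40)–(42) p.266, (47) p.267, (55) p.269, (67)–(68) p.273); Commun. Math. Phys.
102 (1985) 277–309 [Balaban1985Variational] (Thm 1 (8) p.279, (12)–(13) p.279).
-/

set_option autoImplicit false

noncomputable section

namespace Summit.QuantumFields.YangMills.Theorems

open MeasureTheory Set
open scoped Matrix Matrix.Norms.L2Operator
open Literature.MathematicalPhysics.QuantumFieldTheory.Balaban1983to89
open Literature.MathematicalPhysics.QuantumFieldTheory.Balaban1983to89.B10 (pFun)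
open Literature.MathematicalPhysics.QuantumFieldTheory.Balaban1983to89.T3ContinuumYM3Torus
open Literature.MathematicalPhysics.QuantumFieldTheory.Balaban1983to89.T3UnitLawDensityEML (ℰp)
open Literature.MathematicalPhysics.QuantumFieldTheory.Balaban1983to89.T3UnitScaleTilt (θBal)
open Literature.MathematicalPhysics.QuantumFieldTheory.Balaban1983to89.T3LevelShift (fieldShift)
open Literature.MathematicalPhysics.QuantumFieldTheory.Balaban1983to89.T3PrintedRegularMinimiser (regFibrePr)
open Literature.MathematicalPhysics.QuantumFieldTheory.Balaban1983to89.T3PrintedMinimiserExistence (Thm1GlobalMinAt)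
open Literature.MathematicalPhysics.QuantumFieldTheory.Balaban1983to89.ExpMeanLog (deltaSU)
open Literature.MathematicalPhysics.QuantumFieldTheory.Balaban1983to89.B10Eq38TorusDomains (plaqsIn)
open Literature.MathematicalPhysics.QuantumFieldTheory.Balaban1983to89.B10Eq42TorusConstraint (bondsIn lam42 lam42_self)
open Literature.MathematicalPhysics.QuantumFieldTheory.Balaban1985CMP102
open Literature.MathematicalPhysics.QuantumFieldTheory.Balaban1985CMP102.Setting
open Summit.QuantumFields.Balaban3D.Carriers
open Summit.QuantumFields.Balaban3D.Proofs.Primitives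
open Summit.QuantumFields.Balaban3D.Proofs.GroupModelLieC (lieC)
open Summit.QuantumFields.Balaban3D.Proofs.LiftBridge (liftCfg)
open Summit.QuantumFields.Balaban3D.Proofs.TowerAC
open Summit.QuantumFields.Balaban3D.Proofs.StandardAC
open Summit.QuantumFields.Balaban3D.Proofs.InputsAC
open Summit.QuantumFields.Balaban3D.Proofs.AlphaAC (AlphaDataAC)
open Summit.QuantumFields.YangMills.Theorems.AlphaV3AC

/-! ## §1 The selection row, the χ data rows for a handed selection, and the schema without non-emptiness -/

section Schema

variable (F : T3Family) (𝔠 : AlphaConsts F.L (suGroupModel 2).N) (γ : ℝ) (hγ : 0 < γ) (hγ1 : γ ≤ (min 𝔠.gamma0 1) ^ 2)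

/-- **A MEASURABLE IN-CLASS MINIMISER SELECTION** (hypothesis schema, never asserted): composite-minimiser maps `U_k(·, h)` PINNED to `Ut` at `h = triv`, MEASURABLE for every
`(k, h)`, and lying IN the seam-blind adapted class `𝒞_X(k, h, W)` at every ADMISSIBLE non-trivial history of the run's levels `k ≤ K` and every datum `W` — exactly what the χ
assembly reads of `AdaptedToT3X` (no argmin clause).  For print's own regional (42)-minimiser map this is [Balaban1985Variational] Thm 1's regional regularity ((8), (12)–(13))
plus measurable dependence on the datum. [cite: Balaban1985UV3, (42) p.266 + (67)–(68) p.273; Balaban1985Variational, Thm 1 (8) p.279] -/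
def AlphaInputsT3AC.InClassSelT3X (K : ℕ)
    (Ut : (k : ℕ) → GaugeField (F.P K) k (Matrix.specialUnitaryGroup (Fin 2) ℂ) → GaugeField (F.P K) 0 (Matrix.specialUnitaryGroup (Fin 2) ℂ))
    (UkH : (k : ℕ) → Hist (F.P K) k → GaugeField (F.P K) k (Matrix.specialUnitaryGroup (Fin 2) ℂ) →
      GaugeField (F.P K) 0 (Matrix.specialUnitaryGroup (Fin 2) ℂ)) : Prop :=
  (∀ k, UkH k (Hist.triv (F.P K) k) = Ut k) ∧
  (∀ (k : ℕ) (h : Hist (F.P K) k), Measurable (UkH k h)) ∧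
  (∀ (k : ℕ), k ≤ K → ∀ (h : Hist (F.P K) k),
    Hist.Admissible 𝔠.lane.carrier.M₁ (rcolOf (T3Scales F γ hγ (hγ1.trans (sq_min_one_le _ 𝔠.gamma0_pos)) K) 𝔠.lane.carrier) k h →
    h ≠ Hist.triv (F.P K) k →
    ∀ (W : GaugeField (F.P K) k (Matrix.specialUnitaryGroup (Fin 2) ℂ)), UkH k h W ∈ AlphaInputsT3AC.adaptedClassT3X F 𝔠 γ hγ hγ1 K k h W)

/-- **(O‴χ) THE χ CLUSTER-EXPANSION DATA ROWS FOR A HANDED IN-CLASS SELECTION** (hypothesis schema, never asserted): there IS a measurable in-class minimiser selection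
`UkH` pinned to `Ut` (`InClassSelT3X`, with `U_0(·, triv) = id`) together with expansion data `𝔖` and auxiliary data `𝔄` for the pinned AC inputs `XT3` such that the
displayed χ step data `AlphaV3AC.StepDataV3ChiAC` hold at every step `k < K` for the (40) windows `admWindowT3`, and the terminal `Pint_K` rows hold — the three conjuncts of
`DataRowsT3XChi` VERBATIM, for ONE handed selection instead of for every argmin selection.  Print's shape: [Balaban1985UV3] Sect. C for ITS minimisers `U_k(·, h)`.
[cite: Balaban1985UV3, Thm 2 p.272 + (41)–(42) p.266 + (47) p.267 + (55) p.269] -/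
def AlphaInputsT3AC.DataRowsT3XChiSel (K : ℕ)
    (Ut : (k : ℕ) → GaugeField (F.P K) k (Matrix.specialUnitaryGroup (Fin 2) ℂ) → GaugeField (F.P K) 0 (Matrix.specialUnitaryGroup (Fin 2) ℂ)) : Prop :=
  ∃ (UkH : (k : ℕ) → Hist (F.P K) k → GaugeField (F.P K) k (Matrix.specialUnitaryGroup (Fin 2) ℂ) →
      GaugeField (F.P K) 0 (Matrix.specialUnitaryGroup (Fin 2) ℂ))
    (hU0 : ∀ V : GaugeField (F.P K) 0 (Matrix.specialUnitaryGroup (Fin 2) ℂ), UkH 0 (Hist.triv (F.P K) 0) V = V),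
    AlphaInputsT3AC.InClassSelT3X F 𝔠 γ hγ hγ1 K Ut UkH ∧
    ∃ (𝔖 : ∀ k, StepSeries (T3Scales F γ hγ (hγ1.trans (sq_min_one_le _ 𝔠.gamma0_pos)) K)
        (Matrix.specialUnitaryGroup (Fin 2) ℂ) ↥(lieC (suGroupModel 2))
        (nblkOf (T3Scales F γ hγ (hγ1.trans (sq_min_one_le _ 𝔠.gamma0_pos)) K) 𝔠.lane.carrier k) k)
      (𝔄 : AlphaDataAC (suGroupModel 2) 𝔠
        (XT3 F γ hγ (hγ1.trans (sq_min_one_le _ 𝔠.gamma0_pos)) K (fun _ => Set.univ)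
          (fun k => UkH (k + 1) (Hist.triv (F.P K) (k + 1))) UkH hU0 (fun _ _ => rfl)) 𝔖),
      (∀ k, k + 1 ≤ K → StepDataV3ChiAC (suGroupModel 2) 𝔠
        (XT3 F γ hγ (hγ1.trans (sq_min_one_le _ 𝔠.gamma0_pos)) K (fun _ => Set.univ)
          (fun k => UkH (k + 1) (Hist.triv (F.P K) (k + 1))) UkH hU0 (fun _ _ => rfl)) 𝔖 𝔄
        (AlphaInputsT3AC.admWindowT3 F 𝔠 γ hγ hγ1 K) k) ∧
      (∀ h : Hist (F.P K) K, Measurable ((inputOfAC 𝔠.lane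
        (XT3 F γ hγ (hγ1.trans (sq_min_one_le _ 𝔠.gamma0_pos)) K (fun _ => Set.univ)
          (fun k => UkH (k + 1) (Hist.triv (F.P K) (k + 1))) UkH hU0 (fun _ _ => rfl)) 𝔖).Pint K h)) ∧
      (∀ (h : Hist (F.P K) K) (U : GaugeField (F.P K) K (Matrix.specialUnitaryGroup (Fin 2) ℂ)), (inputOfAC 𝔠.lane
        (XT3 F γ hγ (hγ1.trans (sq_min_one_le _ 𝔠.gamma0_pos)) K (fun _ => Set.univ)
          (fun k => UkH (k + 1) (Hist.triv (F.P K) (k + 1))) UkH hU0 (fun _ _ => rfl)) 𝔖).Pint K h U ≤ 𝔄.cP K)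

end Schema

/-- **`DataSchemaT3ACXChiSel F 𝔠 a₀ a₁` — THE SELECTION DATA SCHEMA** (hypothesis schema, OPEN, never asserted): for every coupling `γ ∈ (0, (min γ₀ 1)²]` and run `K`: (N1) the
window inequality, and a trivial-history minimiser family `Ut` with (D5) [7] Thm 1's rows and (O‴χ) a handed in-class selection with its χ data rows — `DataSchemaT3ACXChi`
WITHOUT the non-emptiness conjunct (D6X). [cite: Balaban1985UV3, Thm 2 p.272 + (40)–(42) p.266 + (47) p.267 + (67)–(68) p.273; Balaban1985Variational, Thm 1 (8) p.279] -/
def DataSchemaT3ACXChiSel (F : T3Family) (𝔠 : AlphaConsts F.L (suGroupModel 2).N) (a₀ a₁ : ℝ) : Prop :=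
  ∀ (γ : ℝ) (hγ : 0 < γ) (hγ1 : γ ≤ (min 𝔠.gamma0 1) ^ 2) (K : ℕ),
    AlphaInputsT3AC.WindowIneqT3 F 𝔠 γ K ∧
    ∃ Ut : (k : ℕ) → GaugeField (F.P K) k (Matrix.specialUnitaryGroup (Fin 2) ℂ) → GaugeField (F.P K) 0 (Matrix.specialUnitaryGroup (Fin 2) ℂ),
      AlphaInputsT3AC.TrivMinimiserRowsT3 F 𝔠 γ hγ hγ1 a₀ a₁ K Ut ∧ AlphaInputsT3AC.DataRowsT3XChiSel F 𝔠 γ hγ hγ1 K Ut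

/-! ## §2 The assembly: `DataSchemaT3ACXChiSel ⇒ OfV3ChiAt` -/

section Construction

variable {F : T3Family} {𝔠 : AlphaConsts F.L (suGroupModel 2).N} {a₀ a₁ : ℝ}

/-- **★ THE χ (α) PACKAGE FROM THE SELECTION SCHEMA: `DataSchemaT3ACXChiSel F 𝔠 a₀ a₁ → AlphaInputsT3AC.OfV3ChiAt F 𝔠 a₀ a₁`.**  The χ assembly
`ofV3ChiAt_of_dataSchemaT3XChi` with the HANDED selection `UkH` in place of the constructed argmin selector: rows r2∕r3∕`hLF67`∕`h68` BY MEMBERSHIP (`InClassSelT3X`), `hU` by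
measurability, r1 and r2∕r3 at `triv` (k ≥ 1) = (D5), r3 at `k = 0` = (N1), terminal rows = measurability + (O‴χ).  HONEST YIELD: 2′χ's ∃-package at FIXED `𝔠` modulo the
DISPLAYED selection schema; nothing of the cluster expansion is proved. [cite: Balaban1985UV3, Thm 2 p.272 + (40)–(42) p.266 + (47) p.267 + (67)–(68) p.273; Balaban1985Variational, Thm 1 (8) p.279] -/
theorem AlphaInputsT3AC.ofV3ChiAt_of_dataSchemaT3XChiSel (D : DataSchemaT3ACXChiSel F 𝔠 a₀ a₁) : AlphaInputsT3AC.OfV3ChiAt F 𝔠 a₀ a₁ := by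
  classical
  intro γ hγ hγ1 K
  obtain ⟨hN1, Ut, hT, hD⟩ := D γ hγ hγ1 K
  obtain ⟨hUt0, hUtm, hr1, hr2t, hr3t⟩ := hT
  obtain ⟨UkH, hU0, ⟨hpin, hmeas, hmem⟩, 𝔖, 𝔄, hsteps, hPm, hPb⟩ := hD
  refine ⟨fun _ => Set.univ, fun k => UkH (k + 1) (Hist.triv (F.P K) (k + 1)), UkH, hU0, fun _ _ => rfl, 𝔖, 𝔄, ?_, ⟨?_, ?_, ?_⟩, ?_⟩
  · -- the χ (α) rows: steps = χ-DATA + hU; (67)/(68) by membership (vacuous at the trivial history)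
    refine ⟨fun k hk => (hsteps k hk).toStepAlphaChi (fun h => hmeas k h), fun k hk h hh U => ?_, fun k hk h hh U => ?_⟩
    · by_cases ht : h = Hist.triv (F.P K) k
      · intro e he
        have he' : e ∈ Hist.disc (P := F.P K) (Hist.triv (F.P K) k) := ht ▸ he
        rw [Hist.disc_triv] at he'
        exact absurd he' (Finset.notMem_empty e)
      · exact AlphaInputsT3AC.hLF67_of_mem_adaptedClassT3X (hmem k hk h hh ht U)
    · by_cases ht : h = Hist.triv (F.P K) k
      · intro e he
        have he' : e ∈ Hist.disc (P := F.P K) (Hist.triv (F.P K) k) := ht ▸ he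
        rw [Hist.disc_triv] at he'
        exact absurd he' (Finset.notMem_empty e)
      · exact AlphaInputsT3AC.h68_of_mem_adaptedClassT3X hk (hmem k hk h hh ht U)
  · -- r1: the displayed [7] Thm 1 rows of `Ut`, pinned
    intro n hnK ε₁ ε₀ h1 h2 h3 h4 V hV
    rw [hpin]
    exact hr1 n hnK ε₁ ε₀ h1 h2 h3 h4 V hV
  · -- r2
    intro k hk h W hc b hb
    by_cases ht : h = Hist.triv (F.P K) k
    · subst ht
      rw [hpin]
      rcases Nat.eq_zero_or_pos k with rfl | hk0
      · show Ut 0 W b = W b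
        rw [hUt0]
      · exact hr2t k hk0 hk W hc b hb
    · exact AlphaInputsT3AC.constraint42_of_mem_adaptedClassT3X (hmem k hk h hc.1 ht W) hc b hb
  · -- r3
    intro k hk h W hc i hi s hs q hq
    by_cases ht : h = Hist.triv (F.P K) k
    · subst ht
      rw [hpin]
      rcases Nat.eq_zero_or_pos k with rfl | hk0
      · obtain rfl : i = 0 := Nat.le_zero.mp hi
        obtain rfl : s = 0 := Nat.le_zero.mp hs
        rw [lam42_self] at hq
        have hlt := hc.2 q (Finset.mem_coe.mpr hq)
        have h1 : (((F.L : ℝ) ^ (0 - 0))⁻¹) ^ 2 = 1 := by simp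
        rw [h1, mul_one, Nat.sub_zero]
        show GaugeGroup.dist1 (GaugeField.plaqHol (Ut 0 W) q) ≤ _
        rw [hUt0]
        have hK1 : K - 0 + 1 = K + 1 := by simp
        rw [hK1] at hlt
        exact (hlt.le).trans hN1
      · exact hr3t k hk0 hk W hc i hi s hs q hq
    · exact AlphaInputsT3AC.regularity68Levels_of_mem_adaptedClassT3X (hmem k hk h hc.1 ht W) hc i hi s hs q hq
  · -- terminal rows
    exact ⟨fun h => hmeas K h, hPm, hPb⟩

end Construction

/-! ## §3 OLD ⇒ NEW: the argmin display implies the selection display (nothing lost) -/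

section Compare

variable {F : T3Family} {𝔠 : AlphaConsts F.L (suGroupModel 2).N} {γ : ℝ} {hγ : 0 < γ} {hγ1 : γ ≤ (min 𝔠.gamma0 1) ^ 2} {K : ℕ}

/-- **★ (D6X) + (O″χ) ⇒ (O‴χ)**: given non-emptiness of the seam-blind classes and the χ data rows for EVERY argmin selection, the measurable argmin selector of
`exists_selector_adaptedClassT3X` (pinned to `Ut` at `triv`, `1` off the admissible histories) IS an in-class selection, and (O″χ) hands its data — the selection display
holds.  This is exactly the place where (D6X), hence (FL) ∕ (EL) ∕ the collar, is consumed. [cite: Balaban1985UV3, (42) p.266 + (67)–(68) p.273; Balaban1985Variational, Thm 1 (8) p.279] -/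
theorem AlphaInputsT3AC.dataRowsT3XChiSel_of_dataRows
    {Ut : (k : ℕ) → GaugeField (F.P K) k (Matrix.specialUnitaryGroup (Fin 2) ℂ) → GaugeField (F.P K) 0 (Matrix.specialUnitaryGroup (Fin 2) ℂ)}
    (hne : AlphaInputsT3AC.AdaptedClassNonemptyT3X F 𝔠 γ hγ hγ1 K)
    (hUt0 : ∀ V, Ut 0 V = V) (hUtm : ∀ k, Measurable (Ut k))
    (hD : AlphaInputsT3AC.DataRowsT3XChi F 𝔠 γ hγ hγ1 K Ut) :
    AlphaInputsT3AC.DataRowsT3XChiSel F 𝔠 γ hγ hγ1 K Ut := by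
  classical
  -- the measurable argmin selectors, level by level and admissible history by admissible history
  have hsel := fun (k : ℕ) (hk : k ≤ K) (h : Hist (F.P K) k)
      (_hh : Hist.Admissible 𝔠.lane.carrier.M₁ (rcolOf (T3Scales F γ hγ (hγ1.trans (sq_min_one_le _ 𝔠.gamma0_pos)) K) 𝔠.lane.carrier) k h) =>
    AlphaInputsT3AC.exists_selector_adaptedClassT3X (F := F) (𝔠 := 𝔠) (γ := γ) (hγ := hγ) (hγ1 := hγ1) (K := K) hk h
  let sel : (k : ℕ) → Hist (F.P K) k → GaugeField (F.P K) k (Matrix.specialUnitaryGroup (Fin 2) ℂ) →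
      GaugeField (F.P K) 0 (Matrix.specialUnitaryGroup (Fin 2) ℂ) :=
    fun k h => if hk : k ≤ K then
      (if hh : Hist.Admissible 𝔠.lane.carrier.M₁ (rcolOf (T3Scales F γ hγ (hγ1.trans (sq_min_one_le _ 𝔠.gamma0_pos)) K) 𝔠.lane.carrier) k h
        then Classical.choose (hsel k hk h hh).1 else fun _ => 1)
      else fun _ => 1
  let UkH : (k : ℕ) → Hist (F.P K) k → GaugeField (F.P K) k (Matrix.specialUnitaryGroup (Fin 2) ℂ) →
      GaugeField (F.P K) 0 (Matrix.specialUnitaryGroup (Fin 2) ℂ) :=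
    fun k h => if h = Hist.triv (F.P K) k then Ut k else sel k h
  have hpin : ∀ k, UkH k (Hist.triv (F.P K) k) = Ut k := fun k => if_pos rfl
  have hoff : ∀ (k : ℕ) (h : Hist (F.P K) k), h ≠ Hist.triv (F.P K) k → UkH k h = sel k h := fun k h hh => if_neg hh
  have hU0 : ∀ V : GaugeField (F.P K) 0 (Matrix.specialUnitaryGroup (Fin 2) ℂ), UkH 0 (Hist.triv (F.P K) 0) V = V := fun V => by
    rw [hpin]; exact hUt0 V
  have hmeas : ∀ (k : ℕ) (h : Hist (F.P K) k), Measurable (UkH k h) := by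
    intro k h
    by_cases ht : h = Hist.triv (F.P K) k
    · subst ht; rw [hpin]; exact hUtm k
    · rw [hoff k h ht]
      by_cases hk : k ≤ K
      · by_cases hh : Hist.Admissible 𝔠.lane.carrier.M₁ (rcolOf (T3Scales F γ hγ (hγ1.trans (sq_min_one_le _ 𝔠.gamma0_pos)) K) 𝔠.lane.carrier) k h
        · simp only [sel, dif_pos hk, dif_pos hh]; exact (Classical.choose_spec (hsel k hk h hh).1).1
        · simp only [sel, dif_pos hk, dif_neg hh]; exact measurable_const
      · simp only [sel, dif_neg hk]; exact measurable_const
  have hmin : ∀ (k : ℕ), k ≤ K → ∀ (h : Hist (F.P K) k),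
      Hist.Admissible 𝔠.lane.carrier.M₁ (rcolOf (T3Scales F γ hγ (hγ1.trans (sq_min_one_le _ 𝔠.gamma0_pos)) K) 𝔠.lane.carrier) k h →
      h ≠ Hist.triv (F.P K) k →
      ∀ (W : GaugeField (F.P K) k (Matrix.specialUnitaryGroup (Fin 2) ℂ)), (AlphaInputsT3AC.adaptedClassT3X F 𝔠 γ hγ hγ1 K k h W).Nonempty →
        UkH k h W ∈ AlphaInputsT3AC.adaptedClassT3X F 𝔠 γ hγ hγ1 K k h W ∧
          IsMinOn (fun U : GaugeField (F.P K) 0 (Matrix.specialUnitaryGroup (Fin 2) ℂ) => wilsonAction4 U)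
            (AlphaInputsT3AC.adaptedClassT3X F 𝔠 γ hγ hγ1 K k h W) (UkH k h W) := by
    intro k hk h hh ht W hW
    rw [hoff k h ht]
    simp only [sel, dif_pos hk, dif_pos hh]
    exact (Classical.choose_spec (hsel k hk h hh).1).2.1 W ((hsel k hk h hh).2 W hW)
  have hAd : AlphaInputsT3AC.AdaptedToT3X F 𝔠 γ hγ hγ1 K Ut UkH := ⟨hpin, hmeas, hmin⟩
  obtain ⟨𝔖, 𝔄, hsteps, hPm, hPb⟩ := hD UkH hU0 hAd
  have hmem : ∀ (k : ℕ), k ≤ K → ∀ (h : Hist (F.P K) k),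
      Hist.Admissible 𝔠.lane.carrier.M₁ (rcolOf (T3Scales F γ hγ (hγ1.trans (sq_min_one_le _ 𝔠.gamma0_pos)) K) 𝔠.lane.carrier) k h →
      h ≠ Hist.triv (F.P K) k → ∀ (W : GaugeField (F.P K) k (Matrix.specialUnitaryGroup (Fin 2) ℂ)),
        UkH k h W ∈ AlphaInputsT3AC.adaptedClassT3X F 𝔠 γ hγ hγ1 K k h W :=
    fun k hk h hh ht W => (hmin k hk h hh ht W (hne k hk h hh ht W)).1
  exact ⟨UkH, hU0, ⟨hpin, hmeas, hmem⟩, 𝔖, 𝔄, hsteps, hPm, hPb⟩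

/-- **THE ARGMIN SCHEMA IMPLIES THE SELECTION SCHEMA**: `DataSchemaT3ACXChi F 𝔠 a₀ a₁ → DataSchemaT3ACXChiSel F 𝔠 a₀ a₁` (per `(γ, K)`: keep (N1) and `Ut`, feed (D6X) and
(O″χ) to `dataRowsT3XChiSel_of_dataRows`; `Ut 0 = id` and the measurability of `Ut` are the first two conjuncts of (D5)).
[cite: Balaban1985UV3, Thm 2 p.272 + (42) p.266; Balaban1985Variational, Thm 1 (8) p.279] -/
theorem dataSchemaT3ACXChiSel_of_dataSchemaT3ACXChi {a₀ a₁ : ℝ} (D : DataSchemaT3ACXChi F 𝔠 a₀ a₁) : DataSchemaT3ACXChiSel F 𝔠 a₀ a₁ := by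
  intro γ hγ hγ1 K
  obtain ⟨hN1, hne, Ut, hT, hD⟩ := D γ hγ hγ1 K
  exact ⟨hN1, Ut, hT, AlphaInputsT3AC.dataRowsT3XChiSel_of_dataRows hne hT.1 hT.2.1 hD⟩

end Compare

/-! ## §4 The knits from [7] Thm 1 (displayed) + sizes + (O‴χ) for every pinned family -/

section Knit

open Literature.MathematicalPhysics.QuantumFieldTheory.Balaban1983to89.T3Thresholds (sqrt_le_exp_iff)
open Summit.QuantumFields.Balaban3D.Proofs.Thresholds (Q0 Q0_pos)
open B7Prop2Explicit (C0 C0_pos)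

/-- **`DataSchemaT3ACXChiSel` FROM [7] THM 1 (displayed) + SIZE CONDITIONS + (O‴χ) FOR EVERY PINNED FAMILY** — `dataSchemaT3ACXChi_of_pinnedRows` WITHOUT the (D6X)
hypothesis: the trivial-history pin (`trivMinimiserRowsT3_of_thm1GlobalMinAt`) and the window inequality (`MinimiserPin.windowIneqT3_of_le`) are lane A's theorems; the
supplier's row is (O‴χ) for every pinned [7]-family. [cite: Balaban1985UV3, Thm 2 p.272 + (40)–(42) p.266 + (47) p.267 + (68) p.273; Balaban1985Variational, Thm 1 (8) p.279] -/
theorem AlphaInputsT3AC.dataSchemaT3ACXChiSel_of_pinnedRows (F : T3Family) (𝔠 : AlphaConsts F.L (suGroupModel 2).N) {a₀ a₁ : ℝ}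
    (hT : Thm1GlobalMinAt F.L a₀ a₁ 𝔠.B₃) (hwin : 𝔠.B₃ * a₁ ≤ a₀)
    (hA3 : (143 * ((((3 + 4 : ℕ) : ℝ)) ^ 2 / 4) ^ 2) * (2 * (𝔠.B₃ * a₁)) ≤ 1 / 3)
    (hA2 : 2 * (2 * (𝔠.B₃ * a₁)) ≤ 2 * deltaSU (Fin 2) / (((3 + 4) * F.L : ℕ) : ℝ) ^ 2)
    (hB₃ : 1 ≤ 2 * 𝔠.B₃) (hC : 4 * 𝔠.B₃ * (F.L : ℝ) ^ 2 * avgWindowFactor F.L ≤ 𝔠.C68)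
    (hanti : (min 𝔠.gamma0 1) ^ 2 ≤ Real.exp (2 * (1 - 𝔠.p₀)))
    (hsmall : ∀ γ : ℝ, 0 < γ → γ ≤ (min 𝔠.gamma0 1) ^ 2 →
      ∀ K k : ℕ, 2 * (F.L : ℝ) ^ 2 * avgWindowFactor F.L * θBal F.L γ 𝔠.b₀ 𝔠.p₀ (K - k + 1) ≤ a₁)
    (hrows : ∀ (γ : ℝ) (hγ : 0 < γ) (hγ1 : γ ≤ (min 𝔠.gamma0 1) ^ 2) (K : ℕ)
      (Ut : (k : ℕ) → GaugeField (F.P K) k (Matrix.specialUnitaryGroup (Fin 2) ℂ) → GaugeField (F.P K) 0 (Matrix.specialUnitaryGroup (Fin 2) ℂ)),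
      AlphaInputsT3AC.TrivMinimiserRowsT3 F 𝔠 γ hγ hγ1 a₀ a₁ K Ut → AlphaInputsT3AC.DataRowsT3XChiSel F 𝔠 γ hγ hγ1 K Ut) :
    DataSchemaT3ACXChiSel F 𝔠 a₀ a₁ := by
  intro γ hγ hγ1 K
  have hγ1' : γ ≤ 1 := hγ1.trans (sq_min_one_le _ 𝔠.gamma0_pos)
  have hγe : Real.sqrt γ ≤ Real.exp (1 - 𝔠.p₀) := (sqrt_le_exp_iff hγ.le).mpr (hγ1.trans hanti)
  have hL1 : 1 ≤ F.L := by have := F.hL.2; omega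
  have hw0 : 0 ≤ (F.L : ℝ) ^ 2 * avgWindowFactor F.L := by
    have := avgWindowFactor_pos F
    positivity
  have hC2 : 2 * (F.L : ℝ) ^ 2 * avgWindowFactor F.L ≤ 𝔠.C68 := by nlinarith
  refine ⟨MinimiserPin.windowIneqT3_of_le F 𝔠 hγ hγ1' hγe hC2 K, ?_⟩
  obtain ⟨Ut, hUt⟩ := AlphaInputsT3AC.trivMinimiserRowsT3_of_thm1GlobalMinAt F 𝔠 γ hγ hγ1 K hT hwin hA3 hA2 hB₃
    (fun k _ => hsmall γ hγ hγ1 K k)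
    (fun k i hik hkK => MinimiserPin.C68_dom_of_le hL1 hγ hγ1' hγe 𝔠.b₀_pos 𝔠.p₀_pos.le (avgWindowFactor_pos F).le 𝔠.B₃_pos.le hC K k i hik hkK)
  exact ⟨Ut, hUt, hrows γ hγ hγ1 K Ut hUt⟩

/-- ★ **THE χ (α) PACKAGE FROM [7] THM 1 + SIZE CONDITIONS + (O‴χ)**, through `ofV3ChiAt_of_dataSchemaT3XChiSel` — `ofV3ChiAt_of_pinnedRowsXChi` WITHOUT (D6X).
[cite: Balaban1985UV3, Thm 2 p.272 + (47) p.267; Balaban1985Variational, Thm 1 (8) p.279] -/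
theorem AlphaInputsT3AC.ofV3ChiAt_of_pinnedRowsSelChi (F : T3Family) (𝔠 : AlphaConsts F.L (suGroupModel 2).N) {a₀ a₁ : ℝ}
    (hT : Thm1GlobalMinAt F.L a₀ a₁ 𝔠.B₃) (hwin : 𝔠.B₃ * a₁ ≤ a₀)
    (hA3 : (143 * ((((3 + 4 : ℕ) : ℝ)) ^ 2 / 4) ^ 2) * (2 * (𝔠.B₃ * a₁)) ≤ 1 / 3)
    (hA2 : 2 * (2 * (𝔠.B₃ * a₁)) ≤ 2 * deltaSU (Fin 2) / (((3 + 4) * F.L : ℕ) : ℝ) ^ 2)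
    (hB₃ : 1 ≤ 2 * 𝔠.B₃) (hC : 4 * 𝔠.B₃ * (F.L : ℝ) ^ 2 * avgWindowFactor F.L ≤ 𝔠.C68)
    (hanti : (min 𝔠.gamma0 1) ^ 2 ≤ Real.exp (2 * (1 - 𝔠.p₀)))
    (hsmall : ∀ γ : ℝ, 0 < γ → γ ≤ (min 𝔠.gamma0 1) ^ 2 →
      ∀ K k : ℕ, 2 * (F.L : ℝ) ^ 2 * avgWindowFactor F.L * θBal F.L γ 𝔠.b₀ 𝔠.p₀ (K - k + 1) ≤ a₁)
    (hrows : ∀ (γ : ℝ) (hγ : 0 < γ) (hγ1 : γ ≤ (min 𝔠.gamma0 1) ^ 2) (K : ℕ)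
      (Ut : (k : ℕ) → GaugeField (F.P K) k (Matrix.specialUnitaryGroup (Fin 2) ℂ) → GaugeField (F.P K) 0 (Matrix.specialUnitaryGroup (Fin 2) ℂ)),
      AlphaInputsT3AC.TrivMinimiserRowsT3 F 𝔠 γ hγ hγ1 a₀ a₁ K Ut → AlphaInputsT3AC.DataRowsT3XChiSel F 𝔠 γ hγ hγ1 K Ut) :
    AlphaInputsT3AC.OfV3ChiAt F 𝔠 a₀ a₁ :=
  AlphaInputsT3AC.ofV3ChiAt_of_dataSchemaT3XChiSel (AlphaInputsT3AC.dataSchemaT3ACXChiSel_of_pinnedRows F 𝔠 hT hwin hA3 hA2 hB₃ hC hanti hsmall hrows)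

/-- ★ **THE χ (α) PACKAGE FROM [7] THEOREM 1, THE PRINT-STRENGTH ROW (O‴χ) «for some pinned [7]-family whenever one exists», AND SIZES IN CLOSED FORM** — `…v3RecordXChi`'s
`ofV3ChiAt_of_pinnedRows₂XCChi` WITHOUT (D6X-CHARGED) and WITHOUT `7L + 3 ≤ M₁` (the collar served only the uncharged half of (D6X)); the `C68`-rows give `hanti`∕`hsmall` by lane A's
`MinimiserPin.anti_of_C68` ∕ `small_of_C68`. [cite: Balaban1985Variational, Thm 1 (6)–(8) pp.278–279; Balaban1985UV3, (40)–(42) p.266, (47) p.267, (68) p.273 and Thm 2 p.272] -/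
theorem AlphaInputsT3AC.ofV3ChiAt_of_pinnedRows₂SelChi (F : T3Family) (𝔠 : AlphaConsts F.L (suGroupModel 2).N) {a₀ a₁ : ℝ}
    (hT : Thm1GlobalMinAt F.L a₀ a₁ 𝔠.B₃) (ha₁ : 0 < a₁) (hwin : 𝔠.B₃ * a₁ ≤ a₀)
    (hA3 : (143 * ((((3 + 4 : ℕ) : ℝ)) ^ 2 / 4) ^ 2) * (2 * (𝔠.B₃ * a₁)) ≤ 1 / 3)
    (hA2 : 2 * (2 * (𝔠.B₃ * a₁)) ≤ 2 * deltaSU (Fin 2) / (((3 + 4) * F.L : ℕ) : ℝ) ^ 2)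
    (hB₃ : 1 ≤ 2 * 𝔠.B₃) (hC : 4 * 𝔠.B₃ * (F.L : ℝ) ^ 2 * avgWindowFactor F.L ≤ 𝔠.C68)
    (hCe : Real.exp (𝔠.p₀ - 1) ≤ 3 * C0 3 * 𝔠.C68 * (𝔠.b₀ * Q0 𝔠.p₀))
    (hCa : (𝔠.b₀ * Q0 𝔠.p₀) * (2 * (F.L : ℝ) ^ 2 * avgWindowFactor F.L) ^ 2 ≤ 3 * C0 3 * 𝔠.C68 * a₁ ^ 2)
    (hrows : ∀ (γ : ℝ) (hγ : 0 < γ) (hγ1 : γ ≤ (min 𝔠.gamma0 1) ^ 2) (K : ℕ),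
      (∃ Ut : (k : ℕ) → GaugeField (F.P K) k (Matrix.specialUnitaryGroup (Fin 2) ℂ) → GaugeField (F.P K) 0 (Matrix.specialUnitaryGroup (Fin 2) ℂ),
        AlphaInputsT3AC.TrivMinimiserRowsT3 F 𝔠 γ hγ hγ1 a₀ a₁ K Ut) →
      ∃ Ut : (k : ℕ) → GaugeField (F.P K) k (Matrix.specialUnitaryGroup (Fin 2) ℂ) → GaugeField (F.P K) 0 (Matrix.specialUnitaryGroup (Fin 2) ℂ),
        AlphaInputsT3AC.TrivMinimiserRowsT3 F 𝔠 γ hγ hγ1 a₀ a₁ K Ut ∧ AlphaInputsT3AC.DataRowsT3XChiSel F 𝔠 γ hγ hγ1 K Ut) :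
    AlphaInputsT3AC.OfV3ChiAt F 𝔠 a₀ a₁ := by
  have hL1 : 1 ≤ F.L := by have := F.hL.2; omega
  have hanti := MinimiserPin.anti_of_C68 𝔠 hCe
  have hsmall := MinimiserPin.small_of_C68 𝔠 hL1 ha₁ (avgWindowFactor_pos F) hCa
  refine AlphaInputsT3AC.ofV3ChiAt_of_dataSchemaT3XChiSel fun γ hγ hγ1 K => ?_
  have hγ1' : γ ≤ 1 := hγ1.trans (sq_min_one_le _ 𝔠.gamma0_pos)
  have hγe : Real.sqrt γ ≤ Real.exp (1 - 𝔠.p₀) := (sqrt_le_exp_iff hγ.le).mpr (hγ1.trans hanti)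
  have hw0 : 0 ≤ (F.L : ℝ) ^ 2 * avgWindowFactor F.L := by
    have := avgWindowFactor_pos F
    positivity
  have hC2 : 2 * (F.L : ℝ) ^ 2 * avgWindowFactor F.L ≤ 𝔠.C68 := by nlinarith
  refine ⟨MinimiserPin.windowIneqT3_of_le F 𝔠 hγ hγ1' hγe hC2 K, hrows γ hγ hγ1 K ?_⟩
  exact AlphaInputsT3AC.trivMinimiserRowsT3_of_thm1GlobalMinAt F 𝔠 γ hγ hγ1 K hT hwin hA3 hA2 hB₃
    (fun k _ => hsmall γ hγ hγ1 K k)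
    (fun k i hik hkK => MinimiserPin.C68_dom_of_le hL1 hγ hγ1' hγe 𝔠.b₀_pos 𝔠.p₀_pos.le (avgWindowFactor_pos F).le
      𝔠.B₃_pos.le hC K k i hik hkK)

end Knit

end Summit.QuantumFields.YangMills.Theorems

end
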